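import Summits.BirchSwinnertonDyer.BirchSwinnertonDyer.Theorems.ResidualThetaTransportAtTwoThetaLayerLambdaCongruenceAtTwoCuspSpanGenerationB1
import HarnessLib

/-!
# Route `ResidualThetaTransportAtTwo`, crux Kan⁺ `ThetaLayerLambdaCongruenceAtTwo` (stmt-BirchSwinnertonDyer-20688), node
# (G′)_N = `SignedMuAtTwo.CuspSpanEvenAtTwo N` of 21437 / Kμ⁺ 20689: the DESCENT-CERTIFICATE ENGINE (part 1) — a finite
# per-level table of moves ⟹ the descent, at ARBITRARY odd level `N` (composite included)

Cell `bsd-wall`, width seat `bsd-wall-rtt-p3-w2` g3 (2026-08-28). THEOREMS ONLY (no `def`, no `sorry`, no new axiom);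
`--supports stmt-BirchSwinnertonDyer-20688`; BSD is not proved by this.

THE IDEA. Lead g9's Theorem A (`chi_eq_zero_of_units_four_pow`, p618977) proves the trace form (G″)_N by a DESCENT on `|b(γ)|`
whose moves are right multiplications by `β(δ) = (α, −1; Nκ, δ)`; it needs (U4) «every unit of `ℤ/N` is `±4^k`» (prime powers
with `(ℤ/N)^× = ±⟨4⟩`). Here the move set is ALL `T^m·L_t`-SATURATED `4^k`-COLUMNS: an `η ∈ Γ₀(N)` with second column
`(y₁, w)`, `w ≡ ε4^k (mod N·y₁)`, is killed by `χ` (`L_t η` has lower-right entry EXACTLY `ε4^k`, §1), hence so is `T^m η`, whose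
second column is `(y₁ + m w, w)` — any `(y, w)` with `y ≡ y₁ (mod w)`. A move with column `(y, w)` sends the state `(a, b)` (top
row of `γ`, normalised by `L_t` to `0 ≤ ±a < N|b|`, i.e. `q = ⌊a/|b|⌋ ∈ [0, N)`, `θ = frac ∈ (0,1)`) to the top-right entry
`a y + b w`, of absolute value `< |b|` as soon as `w = −(yq + ⌊yθ⌋ + c)`, `c ∈ {0,1}` (`c = 1` only off `yθ ∈ ℤ`). So (G″)_N
follows from a FINITE TABLE: for every `q < N` a partition of `θ ∈ (0,1)` into open cells (on which `⌊yθ⌋ = fl` is constant) and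
Farey points (single states `(qB + r, B)`, vacuous when `gcd(qB + r, N) > 1`), each with a witness `(y, c, fl, k, y₁, ε)` of
decidable arithmetic. §2 is the descent from the ROW PROPERTY (the table's meaning, stated without definitions); it keeps the
invariant `ā ∈ ±⟨4⟩` and proves `χ = 0` exactly on `d̄⁻¹(±⟨4⟩) ⊇ Γ₁(N)` — what (G′)_N asks. Part 2 (`…CuspSpanDescentRows`)
derives `ψ ∘ d` and the named node, and gives the row-walking lemmas for the per-level table files (seat script
`analysis/emit.py`; tables for `N = 15, 21, 31, 33, 35, 39, 43, …` — the first COMPOSITE levels at which the node is a kernel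
theorem). The plain (unsaturated) column descent fails structurally at composite `N` (`N = 15` near `a/b = 5/2`:
`w ≡ ±2 (mod 5) ∉ ±⟨4⟩`); the saturation `y₁ ≡ y (mod w)` is load-bearing.

References: H. Rademacher, Abh. Math. Sem. Hamburg 7 (1929) 134–148 [Rademacher1929]; A. W. Knapp, *Elliptic curves* (1992)
Prop. 11.22 [Knapp1993]; Ju. I. Manin, Izv. 36 (1972) §1.5–1.9 [Manin1972]; R. Pollack, Duke Math. J. 118 (2003) Conj. 6.3
[Pollack2003].
-/

set_option autoImplicit false
set_option linter.dupNamespace false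

noncomputable section

open scoped MatrixGroups

open CongruenceSubgroup

namespace Summit.BirchSwinnertonDyer.BirchSwinnertonDyer.Theorems.SignedMuAtTwo

/-! ## §1. Entry bookkeeping; the saturated `4^k`-columns are killed; the group `±⟨4⟩ ⊂ (ℤ/N)^×` -/

section Columns

variable {N : ℕ}

variable {χ : Gamma0 N → ZMod 2}

/-- **Saturated `4^k`-columns are killed.** If `χ` is additive, kills the elements of trace `0, ±1, ±2` and the elements whose
lower-right entry is `±4^k` (`k ≥ 1`), and `η ∈ Γ₀(N)` has second column `(y₁, w)` with `N·y₁ ∣ w − ε4^k` (`ε = ±1`, `k ≥ 1`),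
then `χ η = 0`: left multiplication by the parabolic `L_t = (1 0; Nt 1)` changes `w` by `tN y₁`, so some `L_t η` has lower-right
entry EXACTLY `ε4^k`. (Lead g9's `chi_eq_zero_of_natAbs_apply_zero_one_eq_one` is the case `|y₁| = 1`.)
[cite: Rademacher1929, §1] -/
theorem chi_eq_zero_of_col_dvd
    (hadd : ∀ γ δ : Gamma0 N, χ (γ * δ) = χ γ + χ δ)
    (hsmall : ∀ γ : Gamma0 N, ((γ : SL(2, ℤ)) 0 0 + (γ : SL(2, ℤ)) 1 1).natAbs ≤ 2 → χ γ = 0)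
    (hkill : ∀ γ : Gamma0 N, (∃ k : ℕ, 1 ≤ k ∧ ((γ : SL(2, ℤ)) 1 1).natAbs = 4 ^ k) → χ γ = 0)
    (η : Gamma0 N) {k : ℕ} (hk : 1 ≤ k) {ε : ℤ} (hε : ε = 1 ∨ ε = -1)
    (hdvd : (N : ℤ) * (η : SL(2, ℤ)) 0 1 ∣ (η : SL(2, ℤ)) 1 1 - ε * 4 ^ k) : χ η = 0 := by
  obtain ⟨t₀, ht₀⟩ := hdvd
  obtain ⟨L, hL00, -, hL10, hL11⟩ := ThetaLayerLambdaCongruenceAtTwo.exists_gamma0_entries (N := N)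
    1 0 ((N : ℤ) * (-t₀)) 1 (by ring) (dvd_mul_right _ _)
  have hL : χ L = 0 := hsmall L (by rw [hL00, hL11]; rfl)
  have hLη : ((L * η : Gamma0 N) : SL(2, ℤ)) 1 1 = ε * 4 ^ k := by
    rw [gamma0_mul_apply_one_one', hL10, hL11, one_mul]
    linear_combination ht₀
  have hkLη : χ (L * η) = 0 := by
    refine hkill _ ⟨k, hk, ?_⟩
    rw [hLη, Int.natAbs_mul, Int.natAbs_pow]
    rcases hε with rfl | rfl <;> simp
  exact chi_eq_zero_of_mul_left hadd hkLη hL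
/-- `4` is a unit of `ZMod N` for odd `N`. [folklore] -/
theorem isUnit_four_zmod (hN : Odd N) : IsUnit (4 : ZMod N) := by
  have h : Nat.Coprime 4 N := by
    have h2 : Nat.Coprime 2 N := Nat.coprime_two_left.mpr hN
    simpa using Nat.Coprime.pow_left 2 h2
  have := (ZMod.isUnit_iff_coprime 4 N).mpr h
  simpa using this
/-- `4 ^ φ(N) = 1` in `ZMod N` for odd `N` (Euler). [folklore] -/
theorem four_pow_totient [NeZero N] (hN : Odd N) : (4 : ZMod N) ^ Nat.totient N = 1 := by
  obtain ⟨u, hu⟩ := isUnit_four_zmod hN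
  rw [← hu, ← Units.val_pow_eq_pow_val, ZMod.pow_totient, Units.val_one]
/-- Membership in `±⟨4⟩ ⊂ ZMod N` is closed under products. [folklore] -/
theorem pm_four_pow_mul {u v : ZMod N} (hu : ∃ j : ℕ, u = 4 ^ j ∨ u = -(4 ^ j))
    (hv : ∃ j : ℕ, v = 4 ^ j ∨ v = -(4 ^ j)) : ∃ j : ℕ, u * v = 4 ^ j ∨ u * v = -(4 ^ j) := by
  obtain ⟨i, hi⟩ := hu
  obtain ⟨j, hj⟩ := hv
  refine ⟨i + j, ?_⟩
  rw [pow_add]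
  rcases hi with rfl | rfl <;> rcases hj with rfl | rfl
  · exact Or.inl rfl
  · exact Or.inr (by ring)
  · exact Or.inr (by ring)
  · exact Or.inl (by ring)
/-- If `u · (ε 4^k) = 1` in `ZMod N` (`N` odd, `ε = ±1`) then `u ∈ ±⟨4⟩` (`u = ε·4^{k(φ(N)−1)}`). [folklore] -/
theorem pm_four_pow_of_mul_eq_one [NeZero N] (hN : Odd N) {u : ZMod N} {ε : ℤ} {k : ℕ} (hε : ε = 1 ∨ ε = -1)
    (h : u * ((ε : ZMod N) * 4 ^ k) = 1) : ∃ j : ℕ, u = 4 ^ j ∨ u = -(4 ^ j) := by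
  set M := Nat.totient N with hM
  have hMpos : 0 < M := Nat.totient_pos.mpr (NeZero.pos N)
  have hM1 : M = (M - 1) + 1 := (Nat.sub_add_cancel hMpos).symm
  have key : u = (u * 4 ^ k) * 4 ^ (k * (M - 1)) := by
    calc u = u * ((4 : ZMod N) ^ M) ^ k := by rw [four_pow_totient hN, one_pow, mul_one]
      _ = (u * 4 ^ k) * 4 ^ (k * (M - 1)) := by
          rw [← pow_mul, hM1, Nat.add_sub_cancel]
          ring
  refine ⟨k * (M - 1), ?_⟩
  rcases hε with rfl | rfl
  · left
    rw [key]
    push_cast at h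
    rw [one_mul] at h
    rw [h, one_mul]
  · right
    rw [key]
    push_cast at h
    have h' : u * 4 ^ k = -1 := by linear_combination (-1 : ZMod N) * h
    rw [h', neg_one_mul]
/-- An element of `±⟨4⟩ ⊂ ZMod N` (`N` odd) is `±4^k` with `k ≥ 1` (`±1 = ±4^{φ(N)}`). [folklore] -/
theorem pm_four_pow_pos [NeZero N] (hN : Odd N) {u : ZMod N} (hu : ∃ j : ℕ, u = 4 ^ j ∨ u = -(4 ^ j)) :
    ∃ k : ℕ, 1 ≤ k ∧ (u = 4 ^ k ∨ u = -(4 ^ k)) := by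
  obtain ⟨j, hj⟩ := hu
  rcases Nat.eq_zero_or_pos j with rfl | hj0
  · refine ⟨Nat.totient N, Nat.totient_pos.mpr (NeZero.pos N), ?_⟩
    rw [four_pow_totient hN, ← pow_zero (4 : ZMod N)]
    exact hj
  · exact ⟨j, hj0, hj⟩

end Columns

/-! ## §2. The descent from the row property -/

section Descent

variable {N : ℕ} [NeZero N]

/-- **THE DESCENT THEOREM.** Let `N` be odd. Suppose the ROW PROPERTY: for every `q < N` and every state `(r, B)` (`0 < r < B`,
`gcd(r, B) = 1`, `gcd(qB + r, N) = 1`) there is a witness `(y, c, fl, k, y₁, ε)` with `c ≤ 1`, `k ≥ 1`, `ε = ±1`, and, writing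
`V = yq + fl + c`: `gcd(V, N y₁) = 1`, `N y₁ ∣ V + ε4^k`, `V ∣ y₁ − y`, `fl·B ≤ y·r < (fl+1)·B`, `c = 1 → fl·B ≠ y·r`. Then every
additive `χ : Γ₀(N) → ZMod 2` killing the elements of trace `0, ±1, ±2` and the elements with lower-right entry `±4^k` (`k ≥ 1`)
vanishes on every `γ` whose upper-left entry lies in `±⟨4⟩ (mod N)`. Proof = descent on `|b(γ)|`: normalise `a` by `L_t` to
`0 ≤ ±a < N|b|`, read the witness at `(q, r, B) = (⌊a/B⌋, a mod B, |b|)`, right-multiply by `T^m η` (`η` with second column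
`(y₁, −V)`, killed by §1; `m = (y − y₁)/V`): the new upper-right entry is `±(r y − B fl − B c)`, of absolute value `< B`, and the new
upper-left entry is `≡ a·(−V)⁻¹ ∈ ±⟨4⟩`. [cite: Rademacher1929, §1] [cite: Knapp1993, Prop. 11.22] [cite: Manin1972, §1.5] -/
theorem chi_eq_zero_of_rows (hN : Odd N)
    (hrows : ∀ q : ℕ, q < N → ∀ r B : ℕ, 0 < r → r < B → Nat.Coprime r B → Nat.Coprime (q * B + r) N →
      ∃ (y c fl k : ℕ) (y₁ ε : ℤ), c ≤ 1 ∧ 1 ≤ k ∧ (ε = 1 ∨ ε = -1) ∧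
        Int.gcd ((y * q + fl + c : ℕ) : ℤ) (N * y₁) = 1 ∧ (N : ℤ) * y₁ ∣ ((y * q + fl + c : ℕ) : ℤ) + ε * 4 ^ k ∧
        (((y * q + fl + c : ℕ)) : ℤ) ∣ y₁ - y ∧ fl * B ≤ y * r ∧ y * r < (fl + 1) * B ∧ (c = 1 → fl * B ≠ y * r))
    (χ : Gamma0 N → ZMod 2)
    (hadd : ∀ γ δ : Gamma0 N, χ (γ * δ) = χ γ + χ δ)
    (hsmall : ∀ γ : Gamma0 N, ((γ : SL(2, ℤ)) 0 0 + (γ : SL(2, ℤ)) 1 1).natAbs ≤ 2 → χ γ = 0)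
    (hkill : ∀ γ : Gamma0 N, (∃ k : ℕ, 1 ≤ k ∧ ((γ : SL(2, ℤ)) 1 1).natAbs = 4 ^ k) → χ γ = 0) :
    ∀ γ : Gamma0 N, (∃ j : ℕ, (((γ : SL(2, ℤ)) 0 0 : ℤ) : ZMod N) = 4 ^ j ∨
      (((γ : SL(2, ℤ)) 0 0 : ℤ) : ZMod N) = -(4 ^ j)) → χ γ = 0 := by
  -- strong induction on `|b(γ)|`
  suffices h : ∀ n : ℕ, ∀ γ : Gamma0 N, ((γ : SL(2, ℤ)) 0 1).natAbs = n →
      (∃ j : ℕ, (((γ : SL(2, ℤ)) 0 0 : ℤ) : ZMod N) = 4 ^ j ∨ (((γ : SL(2, ℤ)) 0 0 : ℤ) : ZMod N) = -(4 ^ j)) →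
      χ γ = 0 from fun γ hγ ↦ h _ γ rfl hγ
  intro n
  induction n using Nat.strong_induction_on with
  | _ n ih =>
  intro γ hn hG
  set a := (γ : SL(2, ℤ)) 0 0 with hadef
  set b := (γ : SL(2, ℤ)) 0 1 with hbdef
  set c₀ := (γ : SL(2, ℤ)) 1 0 with hcdef
  set d := (γ : SL(2, ℤ)) 1 1 with hddef
  have hdet : a * d - b * c₀ = 1 :=
    (by have h := Matrix.SpecialLinearGroup.det_coe (γ : SL(2, ℤ)); rwa [Matrix.det_fin_two] at h)
  have hNc : (N : ℤ) ∣ c₀ :=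
    (by have h := Gamma0_mem.mp γ.2; exact (ZMod.intCast_zmod_eq_zero_iff_dvd _ N).mp (by exact_mod_cast h))
  rcases Nat.lt_or_ge n 2 with hlt | hge
  · interval_cases n
    · -- `b = 0`: `a d = 1`, `γ = ±L^m`, trace `±2`
      have hb0 : b = 0 := Int.natAbs_eq_zero.mp hn
      rw [hb0, zero_mul, sub_zero] at hdet
      refine hsmall γ ?_
      rw [← hadef, ← hddef]
      rcases Int.eq_one_or_neg_one_of_mul_eq_one' hdet with ⟨ha, hd⟩ | ⟨ha, hd⟩ <;> rw [ha, hd] <;> rfl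
    · -- `|b| = 1`: `d ≡ a⁻¹ ∈ ±⟨4⟩`, so `N·b ∣ d − ε4^k`
      have had : (a : ZMod N) * (d : ZMod N) = 1 := by
        obtain ⟨c₁, hc₁⟩ := hNc
        have : ((a * d - b * c₀ : ℤ) : ZMod N) = 1 := by rw [hdet]; simp
        rw [hc₁] at this
        push_cast at this
        simpa using this
      have hdG : ∃ j : ℕ, (d : ZMod N) = 4 ^ j ∨ (d : ZMod N) = -(4 ^ j) := by
        obtain ⟨j, hj⟩ := hG
        rcases hj with hj | hj
        · exact pm_four_pow_of_mul_eq_one hN (ε := 1) (k := j) (Or.inl rfl)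
            (by push_cast; rw [one_mul, ← hj, mul_comm]; exact had)
        · exact pm_four_pow_of_mul_eq_one hN (ε := -1) (k := j) (Or.inr rfl)
            (by push_cast; rw [neg_one_mul, ← hj, mul_comm]; exact had)
      obtain ⟨k, hk, hdk⟩ := pm_four_pow_pos hN hdG
      obtain ⟨ε, hε, hdvdN⟩ : ∃ ε : ℤ, (ε = 1 ∨ ε = -1) ∧ (N : ℤ) ∣ d - ε * 4 ^ k := by
        rcases hdk with h | h
        · refine ⟨1, Or.inl rfl, (ZMod.intCast_zmod_eq_zero_iff_dvd _ N).mp ?_⟩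
          push_cast; rw [h]; ring
        · refine ⟨-1, Or.inr rfl, (ZMod.intCast_zmod_eq_zero_iff_dvd _ N).mp ?_⟩
          push_cast; rw [h]; ring
      refine chi_eq_zero_of_col_dvd hadd hsmall hkill γ hk hε ?_
      rw [← hbdef, ← hddef]
      rcases Int.natAbs_eq b with h | h <;> rw [hn] at h <;> rw [h]
      · simpa using hdvdN
      · push_cast
        rw [mul_neg_one, Int.neg_dvd]
        exact hdvdN
  · -- `|b| ≥ 2`: one descent step
    have hb0 : b ≠ 0 := by
      intro h; rw [h, Int.natAbs_zero] at hn; omega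
    -- sign and absolute value of `b`
    set B : ℕ := b.natAbs with hBdef
    set s : ℤ := b.sign with hsdef
    have hsB : s * (B : ℤ) = b := Int.sign_mul_natAbs b
    have hs : s = 1 ∨ s = -1 := by
      rcases lt_trichotomy b 0 with h | h | h
      · exact Or.inr (Int.sign_eq_neg_one_of_neg h)
      · exact absurd h hb0
      · exact Or.inl (Int.sign_eq_one_of_pos h)
    have hss : s * s = 1 := by rcases hs with h | h <;> rw [h] <;> norm_num
    have hBn : B = n := hn
    have hB2 : 2 ≤ B := hBn ▸ hge
    have hBpos : (0 : ℤ) < B := by exact_mod_cast (show 0 < B by omega)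
    -- normalise `a`: `A = (s a) mod (N B) ∈ [0, N B)`
    set M : ℤ := (N : ℤ) * B with hMdef
    have hMpos : 0 < M := mul_pos (by exact_mod_cast NeZero.pos N) hBpos
    set A : ℤ := (s * a) % M with hAdef
    have hA0 : 0 ≤ A := Int.emod_nonneg _ hMpos.ne'
    have hAM : A < M := Int.emod_lt_of_pos _ hMpos
    have hAeq : s * a = M * ((s * a) / M) + A := by
      have := Int.emod_add_mul_ediv (s * a) M
      linear_combination -this
    set m₀ : ℤ := (s * a) / M with hm₀
    -- the integers `q, r`
    set An : ℕ := A.toNat with hAn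
    have hAnA : (An : ℤ) = A := Int.toNat_of_nonneg hA0
    set q : ℕ := An / B with hqdef
    set r : ℕ := An % B with hrdef
    have hqr : B * q + r = An := Nat.div_add_mod An B
    have hAnlt : An < N * B := by
      have : (An : ℤ) < (N : ℤ) * B := by rw [hAnA]; exact hAM
      exact_mod_cast this
    have hq : q < N := Nat.div_lt_of_lt_mul (by rw [mul_comm]; exact hAnlt)
    have hrB : r < B := Nat.mod_lt _ (by omega)
    -- coprimality facts
    have hcop_ab : IsCoprime a b := ⟨d, -c₀, by linear_combination hdet⟩
    have hcop_AB : IsCoprime A (B : ℤ) := by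
      have h1 : IsCoprime (s * a) b := by
        rcases hs with h | h <;> rw [h]
        · simpa using hcop_ab
        · simpa using hcop_ab.neg_left
      have h2 : IsCoprime (s * a) (B : ℤ) := by
        rw [← hsB] at h1
        exact (h1.of_mul_right_right : IsCoprime (s * a) (B : ℤ))
      have hA' : A = s * a + (B : ℤ) * (-(N : ℤ) * m₀) := by rw [hAeq, hMdef]; ring
      rw [hA']
      exact h2.add_mul_left_left _
    have hcopN_a : IsCoprime a (N : ℤ) := by
      obtain ⟨c₁, hc₁⟩ := hNc
      exact ⟨d, -(b * c₁), by rw [hc₁] at hdet; linear_combination hdet⟩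
    have hcop_AN : IsCoprime A (N : ℤ) := by
      have h1 : IsCoprime (s * a) (N : ℤ) := by
        rcases hs with h | h <;> rw [h]
        · simpa using hcopN_a
        · simpa using hcopN_a.neg_left
      have hA' : A = s * a + (N : ℤ) * (-(B : ℤ) * m₀) := by rw [hAeq, hMdef]; ring
      rw [hA']
      exact h1.add_mul_left_left _
    have hgcdAnB : Nat.Coprime An B := by
      rw [← Nat.isCoprime_iff_coprime, hAnA]; exact hcop_AB
    have hcop_rB : Nat.Coprime r B := by
      rw [Nat.Coprime, hrdef, ← Nat.gcd_rec, Nat.gcd_comm]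
      exact hgcdAnB
    have hrpos : 0 < r := by
      rcases Nat.eq_zero_or_pos r with h | h
      · exfalso
        have : Nat.gcd r B = 1 := hcop_rB
        rw [h, Nat.gcd_zero_left] at this
        omega
      · exact h
    have hunit : Nat.Coprime (q * B + r) N := by
      have : q * B + r = An := by rw [mul_comm]; exact hqr
      rw [this, ← Nat.isCoprime_iff_coprime, hAnA]
      exact hcop_AN
    -- read the witness
    obtain ⟨y, c, fl, k, y₁, ε, hc1, hk, hε, hgcd, hdvd1, hdvd2, hfl1, hfl2, hfl3⟩ :=
      hrows q hq r B hrpos hrB hcop_rB hunit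
    set V : ℕ := y * q + fl + c with hVdef
    -- the element `η` with second column `(y₁, -V)`
    obtain ⟨u, v, huv⟩ := Int.isCoprime_iff_gcd_eq_one.mpr hgcd
    obtain ⟨η, e00, e01, e10, e11⟩ := ThetaLayerLambdaCongruenceAtTwo.exists_gamma0_entries (N := N)
      (-u) y₁ ((N : ℤ) * (-v)) (-(V : ℤ)) (by linear_combination huv) (dvd_mul_right _ _)
    have hη : χ η = 0 := by
      refine chi_eq_zero_of_col_dvd hadd hsmall hkill η hk hε ?_
      rw [e01, e11]
      have : -(V : ℤ) - ε * 4 ^ k = -((V : ℤ) + ε * 4 ^ k) := by ring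
      rw [this, Int.dvd_neg]
      exact hdvd1
    -- `T^{m}` with `y₁ - y = -V·m'`... : second column of `T η` becomes `(y, -V)`
    obtain ⟨m, hm⟩ := hdvd2
    obtain ⟨Tm, t00, t01, t10, t11⟩ := ThetaLayerLambdaCongruenceAtTwo.exists_gamma0_entries (N := N)
      1 m 0 1 (by ring) (dvd_zero _)
    have hTm : χ Tm = 0 := hsmall Tm (by rw [t00, t11]; rfl)
    have f00 : ((Tm * η : Gamma0 N) : SL(2, ℤ)) 0 0 = -u + m * ((N : ℤ) * (-v)) := by
      rw [gamma0_mul_apply_zero_zero', t00, t01, e00, e10]; ring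
    have f01 : ((Tm * η : Gamma0 N) : SL(2, ℤ)) 0 1 = y := by
      rw [gamma0_mul_apply_zero_one, t00, t01, e01, e11]; linear_combination hm
    have f10 : ((Tm * η : Gamma0 N) : SL(2, ℤ)) 1 0 = (N : ℤ) * (-v) := by
      rw [ThetaLayerLambdaCongruenceAtTwo.gamma0_mul_apply_one_zero, t10, t11, e00, e10]; ring
    have f11 : ((Tm * η : Gamma0 N) : SL(2, ℤ)) 1 1 = -(V : ℤ) := by
      rw [gamma0_mul_apply_one_one', t10, t11, e01, e11]; ring
    have hTη : χ (Tm * η) = 0 := by rw [hadd, hTm, hη, add_zero]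
    -- normalise `a` by `L_t`: `γ L` has upper-left entry `s A`
    obtain ⟨L, l00, l01, l10, l11⟩ := ThetaLayerLambdaCongruenceAtTwo.exists_gamma0_entries (N := N)
      1 0 ((N : ℤ) * (-m₀)) 1 (by ring) (dvd_mul_right _ _)
    have hL : χ L = 0 := hsmall L (by rw [l00, l11]; rfl)
    have hAeq' : A = s * a - M * m₀ := by linear_combination (-1 : ℤ) * hAeq
    have g00 : ((γ * L : Gamma0 N) : SL(2, ℤ)) 0 0 = s * A := by
      rw [gamma0_mul_apply_zero_zero', l00, l10, ← hadef, ← hbdef, mul_one, ← hsB, hAeq', hMdef]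
      linear_combination (-a) * hss
    have g01 : ((γ * L : Gamma0 N) : SL(2, ℤ)) 0 1 = b := by
      rw [gamma0_mul_apply_zero_one, l01, l11, ← hadef, ← hbdef]; ring
    -- the new element
    set γ' : Gamma0 N := γ * L * (Tm * η) with hγ'
    have h01 : ((γ' : Gamma0 N) : SL(2, ℤ)) 0 1 = s * (A * y - (B : ℤ) * V) := by
      rw [hγ', gamma0_mul_apply_zero_one, g00, g01, f01, f11, ← hsB]; ring
    have hAqr : A = (q : ℤ) * B + r := by
      rw [← hAnA, ← hqr]; push_cast; ring
    have hbound : (A * y - (B : ℤ) * V).natAbs < B := by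
      have e1 : (fl : ℤ) * B ≤ (y : ℤ) * r := by exact_mod_cast hfl1
      have e2 : (y : ℤ) * r < ((fl : ℤ) + 1) * B := by exact_mod_cast hfl2
      have hval : A * y - (B : ℤ) * V = (y : ℤ) * r - (fl : ℤ) * B - (c : ℤ) * B := by
        rw [hAqr, hVdef]; push_cast; ring
      have key : -(B : ℤ) < (y : ℤ) * r - (fl : ℤ) * B - (c : ℤ) * B ∧
          (y : ℤ) * r - (fl : ℤ) * B - (c : ℤ) * B < B := by
        rcases (show c = 0 ∨ c = 1 by omega) with hc | hc
        · subst hc; push_cast; constructor <;> linarith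
        · subst hc
          have e3 : (fl : ℤ) * B ≠ (y : ℤ) * r := by exact_mod_cast hfl3 rfl
          have e4 : (fl : ℤ) * B < (y : ℤ) * r := lt_of_le_of_ne e1 e3
          push_cast; constructor <;> linarith
      have : (((A * y - (B : ℤ) * V).natAbs : ℕ) : ℤ) < (B : ℤ) := by
        rw [Int.natCast_natAbs, hval]; exact abs_lt.mpr key
      exact_mod_cast this
    have hlt : (((γ' : Gamma0 N) : SL(2, ℤ)) 0 1).natAbs < n := by
      rw [h01, Int.natAbs_mul, ← hBn]
      rcases hs with h | h <;> rw [h] <;> simpa using hbound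
    -- the invariant: the upper-left entry of `γ'` is `≡ a · (-u)`, and `(-u)·(ε 4^k) ≡ (-u)(-V) = u V ≡ 1`
    have hssZ : (s : ZMod N) * (s : ZMod N) = 1 := by exact_mod_cast congrArg (fun z : ℤ ↦ (z : ZMod N)) hss
    have hcast : ((((γ' : Gamma0 N) : SL(2, ℤ)) 0 0 : ℤ) : ZMod N) = (a : ZMod N) * ((-u : ℤ) : ZMod N) := by
      rw [hγ', gamma0_mul_apply_zero_zero', g00, g01, f00, f10, hAeq', hMdef, ← hsB]
      push_cast
      rw [ZMod.natCast_self]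
      linear_combination (-(a : ZMod N) * (u : ZMod N)) * hssZ
    have hG' : ∃ j : ℕ, ((((γ' : Gamma0 N) : SL(2, ℤ)) 0 0 : ℤ) : ZMod N) = 4 ^ j ∨
        ((((γ' : Gamma0 N) : SL(2, ℤ)) 0 0 : ℤ) : ZMod N) = -(4 ^ j) := by
      rw [hcast]
      refine pm_four_pow_mul hG (pm_four_pow_of_mul_eq_one hN hε (k := k) ?_)
      obtain ⟨w₁, hw₁⟩ := (dvd_mul_right (N : ℤ) y₁).trans hdvd1
      have hVmod : ((V : ℕ) : ZMod N) = -((ε : ZMod N) * 4 ^ k) := by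
        have h1 := congrArg (fun z : ℤ ↦ (z : ZMod N)) hw₁
        push_cast at h1
        rw [ZMod.natCast_self, zero_mul] at h1
        linear_combination h1
      have huv' : ((u : ℤ) : ZMod N) * ((V : ℕ) : ZMod N) = 1 := by
        have h1 := congrArg (fun z : ℤ ↦ (z : ZMod N)) huv
        push_cast at h1
        rw [ZMod.natCast_self] at h1
        linear_combination h1
      rw [hVmod] at huv'
      push_cast
      linear_combination huv'
    -- conclude
    have hγ'0 : χ γ' = 0 := ih _ hlt γ' rfl hG'
    have h1 : χ (γ * L) = 0 := chi_eq_zero_of_mul_right hadd (by rw [hγ'] at hγ'0; exact hγ'0) hTη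
    exact chi_eq_zero_of_mul_right hadd h1 hL

end Descent

end Summit.BirchSwinnertonDyer.BirchSwinnertonDyer.Theorems.SignedMuAtTwo

end
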